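import Mathlib
import Summits.Ventures.PercRepro2.HCov
import Summits.Ventures.PercRepro2.HCovSwap
import Summits.Ventures.PercRepro2.PendantO
import Summits.Ventures.PercRepro2.PendantRoot
import Summits.Ventures.PercRepro2.PendantBRow
import Summits.Ventures.PercRepro2.RootLeafOTheorem
import Summits.Ventures.PercRepro2.RootLeafBTheorem
import Summits.Ventures.PercRepro2.RootLeafA3
import Summits.Ventures.PercRepro2.CutVertexPaths
import Summits.Ventures.PercRepro2.CutOneFar

/-!
# One mark behind a MARKED cut vertex: (HCOV) by composition with the pendant theorems
(blind cell PercRepro2, typer-1 g48)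

The one-far-mark equivalence `CutOneFar.Gc_eq_reduced` replaces the side of the cut vertex `v`
that carries the single mark `w` by a pendant edge `{v, w}`; when `v` is itself a mark, the reduced
graph has `w` as a LEAF AT A MARK, where the cell's pendant theorems decide.  Hence (HCOV) on every
weighted instance in which a cut vertex that is a mark separates one mark from the other three:

* `a₃` behind `o` / behind `a₂` / behind `a₁` / behind `b` (**`HCov_a3_behind_o`**,
  **`HCov_a3_behind_a2`**, **`HCov_a3_behind_a1`**, **`HCov_a3_behind_b`**; the pendant theorems
  `PendantO.HCov_pendant_o`, `PendantRoot.HCov_pendant_root` / `HCov_pendant_root'`,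
  `PendantB.HCov_pendant_b`);
* the root `a₁` behind `o` / behind `b` / behind `a₃` (**`HCov_a1_behind_o`**,
  **`HCov_a1_behind_b`**, **`HCov_a1_behind_a3`**; the root-leaf theorems
  `RootLeafO.HCov_root_leaf_o`, `RootLeafB.HCov_root_leaf_b`, `RootLeafA3.HCov_root_leaf_a3`).

The left side is ARBITRARY (any weighted graph hanging at `v` that contains the far mark and no
other mark); the classes strictly contain the pendant instances (left side = one edge).
-/

namespace Summit.Ventures.PercRepro2

open CovForm CutVertexM9 CutOneFar

namespace CutOneFar

section Marked

variable {V : Type*} {E : Type*} [Fintype E] [DecidableEq E] [Fintype V] [DecidableEq V]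
  {R : Type*} [Field R] [LinearOrder R] [IsStrictOrderedRing R]
variable {ends : E → Sym2 V} {side : E → Bool} {L : Set V} {v : V} {Rt : Set V} {w : V}

omit [Fintype E] [DecidableEq E] [Fintype V] [DecidableEq V] in
/-- The far mark is not the cut vertex. -/
lemma far_ne_cut (h : CutVertex ends side L v Rt) (hw : w ∈ L) : w ≠ v :=
  fun hwv => h.vL (hwv ▸ hw)

omit [Fintype E] [DecidableEq E] [Fintype V] [DecidableEq V] in
/-- The far mark is not a right vertex. -/
lemma far_ne_right (h : CutVertex ends side L v Rt) (hw : w ∈ L) {z : V} (hz : z ∈ Rt ∨ z = v) :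
    w ≠ z := by
  rintro rfl
  rcases hz with hz | rfl
  · exact h.disj w hw hz
  · exact h.vL hw

omit [Fintype E] [DecidableEq E] [Fintype V] [DecidableEq V] in
/-- In the reduced graph the far mark is a leaf: its only edge is the pendant edge. -/
lemma leaf_reduced (h : CutVertex ends side L v Rt) (hw : w ∈ L) :
    ∀ e : REdge side, w ∈ rends ends side v w e → e = Sum.inr () := by
  rintro (e | e) he
  · exfalso
    rcases h.right e.1 e.2 w he with hR | hv
    · exact h.disj w hw hR
    · exact h.vL (hv ▸ hw)
  · rfl

omit [Fintype E] [DecidableEq E] [Fintype V] [DecidableEq V] in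
/-- The pendant edge of the reduced graph. -/
lemma rends_pendant (ends : E → Sym2 V) (side : E → Bool) (v w : V) :
    rends ends side v w (Sum.inr ()) = s(w, v) :=
  Sym2.eq_swap

/-- **`a₃` behind the cut vertex `o`**: (HCOV). -/
theorem HCov_a3_behind_o (h : CutVertex ends side L v Rt) {p : E → R} (hp : IsProbVec p)
    {a₁ a₂ a₃ b : V} (hw : a₃ ∈ L) (h1 : a₁ ∈ Rt ∨ a₁ = v) (h2 : a₂ ∈ Rt ∨ a₂ = v)
    (hb : b ∈ Rt ∨ b = v) : HCov p ends v a₁ a₂ a₃ b := by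
  refine HCov_of_reduced h hw p v a₁ a₂ a₃ b ?_ ?_
  · intro m hm
    simp only [Set.mem_insert_iff, Set.mem_singleton_iff] at hm
    rcases hm with rfl | rfl | rfl | rfl | rfl
    · exact Or.inr (Or.inr rfl)
    · exact Or.inr h1
    · exact Or.inr h2
    · exact Or.inl rfl
    · exact Or.inr hb
  · exact PendantO.HCov_pendant_o _ _ (isProbVec_rweights_leftProb ends side v a₃ hp)
      (rends_pendant ends side v a₃) (leaf_reduced h hw) (far_ne_cut h hw)
      (far_ne_right h hw h1) (far_ne_right h hw h2) (far_ne_right h hw hb).symm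

/-- **`a₃` behind the cut vertex `a₂`**: (HCOV). -/
theorem HCov_a3_behind_a2 (h : CutVertex ends side L v Rt) {p : E → R} (hp : IsProbVec p)
    {o a₁ a₃ b : V} (hw : a₃ ∈ L) (ho : o ∈ Rt ∨ o = v) (h1 : a₁ ∈ Rt ∨ a₁ = v)
    (hb : b ∈ Rt ∨ b = v) : HCov p ends o a₁ v a₃ b := by
  refine HCov_of_reduced h hw p o a₁ v a₃ b ?_ ?_
  · intro m hm
    simp only [Set.mem_insert_iff, Set.mem_singleton_iff] at hm
    rcases hm with rfl | rfl | rfl | rfl | rfl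
    · exact Or.inr ho
    · exact Or.inr h1
    · exact Or.inr (Or.inr rfl)
    · exact Or.inl rfl
    · exact Or.inr hb
  · exact PendantRoot.HCov_pendant_root _ _ (isProbVec_rweights_leftProb ends side v a₃ hp)
      (rends_pendant ends side v a₃) (leaf_reduced h hw) (far_ne_cut h hw)
      (far_ne_right h hw h1) (far_ne_right h hw ho).symm (far_ne_right h hw hb).symm

/-- **`a₃` behind the cut vertex `a₁`**: (HCOV). -/
theorem HCov_a3_behind_a1 (h : CutVertex ends side L v Rt) {p : E → R} (hp : IsProbVec p)
    {o a₂ a₃ b : V} (hw : a₃ ∈ L) (ho : o ∈ Rt ∨ o = v) (h2 : a₂ ∈ Rt ∨ a₂ = v)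
    (hb : b ∈ Rt ∨ b = v) : HCov p ends o v a₂ a₃ b := by
  refine HCov_of_reduced h hw p o v a₂ a₃ b ?_ ?_
  · intro m hm
    simp only [Set.mem_insert_iff, Set.mem_singleton_iff] at hm
    rcases hm with rfl | rfl | rfl | rfl | rfl
    · exact Or.inr ho
    · exact Or.inr (Or.inr rfl)
    · exact Or.inr h2
    · exact Or.inl rfl
    · exact Or.inr hb
  · exact PendantRoot.HCov_pendant_root' _ (isProbVec_rweights_leftProb ends side v a₃ hp) _
      (rends_pendant ends side v a₃) (leaf_reduced h hw) (far_ne_cut h hw)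
      (far_ne_right h hw h2) (far_ne_right h hw ho).symm (far_ne_right h hw hb).symm

/-- **`a₃` behind the cut vertex `b`**: (HCOV). -/
theorem HCov_a3_behind_b (h : CutVertex ends side L v Rt) {p : E → R} (hp : IsProbVec p)
    {o a₁ a₂ a₃ : V} (hw : a₃ ∈ L) (ho : o ∈ Rt ∨ o = v) (h1 : a₁ ∈ Rt ∨ a₁ = v)
    (h2 : a₂ ∈ Rt ∨ a₂ = v) : HCov p ends o a₁ a₂ a₃ v := by
  refine HCov_of_reduced h hw p o a₁ a₂ a₃ v ?_ ?_
  · intro m hm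
    simp only [Set.mem_insert_iff, Set.mem_singleton_iff] at hm
    rcases hm with rfl | rfl | rfl | rfl | rfl
    · exact Or.inr ho
    · exact Or.inr h1
    · exact Or.inr h2
    · exact Or.inl rfl
    · exact Or.inr (Or.inr rfl)
  · exact PendantB.HCov_pendant_b _ _ (isProbVec_rweights_leftProb ends side v a₃ hp)
      (rends_pendant ends side v a₃) (leaf_reduced h hw) (far_ne_cut h hw)
      (far_ne_right h hw h1) (far_ne_right h hw h2) (far_ne_right h hw ho).symm

/-- **The root `a₁` behind the cut vertex `o`**: (HCOV). -/
theorem HCov_a1_behind_o (h : CutVertex ends side L v Rt) {p : E → R} (hp : IsProbVec p)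
    {a₁ a₂ a₃ b : V} (hw : a₁ ∈ L) (h2 : a₂ ∈ Rt ∨ a₂ = v) (h3 : a₃ ∈ Rt ∨ a₃ = v)
    (hb : b ∈ Rt ∨ b = v) : HCov p ends v a₁ a₂ a₃ b := by
  refine HCov_of_reduced h hw p v a₁ a₂ a₃ b ?_ ?_
  · intro m hm
    simp only [Set.mem_insert_iff, Set.mem_singleton_iff] at hm
    rcases hm with rfl | rfl | rfl | rfl | rfl
    · exact Or.inr (Or.inr rfl)
    · exact Or.inl rfl
    · exact Or.inr h2
    · exact Or.inr h3
    · exact Or.inr hb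
  · exact RootLeafO.HCov_root_leaf_o _ _ (isProbVec_rweights_leftProb ends side v a₁ hp)
      (rends_pendant ends side v a₁) (leaf_reduced h hw) (far_ne_cut h hw)
      (far_ne_right h hw h2) (far_ne_right h hw h3) (far_ne_right h hw hb).symm

/-- **The root `a₁` behind the cut vertex `b`**: (HCOV). -/
theorem HCov_a1_behind_b (h : CutVertex ends side L v Rt) {p : E → R} (hp : IsProbVec p)
    {o a₁ a₂ a₃ : V} (hw : a₁ ∈ L) (ho : o ∈ Rt ∨ o = v) (h2 : a₂ ∈ Rt ∨ a₂ = v)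
    (h3 : a₃ ∈ Rt ∨ a₃ = v) : HCov p ends o a₁ a₂ a₃ v := by
  refine HCov_of_reduced h hw p o a₁ a₂ a₃ v ?_ ?_
  · intro m hm
    simp only [Set.mem_insert_iff, Set.mem_singleton_iff] at hm
    rcases hm with rfl | rfl | rfl | rfl | rfl
    · exact Or.inr ho
    · exact Or.inl rfl
    · exact Or.inr h2
    · exact Or.inr h3
    · exact Or.inr (Or.inr rfl)
  · exact RootLeafB.HCov_root_leaf_b _ _ (isProbVec_rweights_leftProb ends side v a₁ hp)
      (rends_pendant ends side v a₁) (leaf_reduced h hw) (far_ne_cut h hw)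
      (far_ne_right h hw h2) (far_ne_right h hw h3) (far_ne_right h hw ho).symm

/-- **The root `a₁` behind the cut vertex `a₃`**: (HCOV). -/
theorem HCov_a1_behind_a3 (h : CutVertex ends side L v Rt) {p : E → R} (hp : IsProbVec p)
    {o a₁ a₂ b : V} (hw : a₁ ∈ L) (ho : o ∈ Rt ∨ o = v) (h2 : a₂ ∈ Rt ∨ a₂ = v)
    (hb : b ∈ Rt ∨ b = v) : HCov p ends o a₁ a₂ v b := by
  refine HCov_of_reduced h hw p o a₁ a₂ v b ?_ ?_
  · intro m hm
    simp only [Set.mem_insert_iff, Set.mem_singleton_iff] at hm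
    rcases hm with rfl | rfl | rfl | rfl | rfl
    · exact Or.inr ho
    · exact Or.inl rfl
    · exact Or.inr h2
    · exact Or.inr (Or.inr rfl)
    · exact Or.inr hb
  · exact RootLeafA3.HCov_root_leaf_a3 _ _ (isProbVec_rweights_leftProb ends side v a₁ hp)
      (rends_pendant ends side v a₁) (leaf_reduced h hw) (far_ne_cut h hw)
      (far_ne_right h hw h2) (far_ne_right h hw ho).symm (far_ne_right h hw hb).symm

end Marked

end CutOneFar

end Summit.Ventures.PercRepro2
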